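import Literature.AlgebraicGeometry.Resolution.MacaulayficationSecantSequences
import Literature.AlgebraicGeometry.Resolution.CohenMacaulayCatenary
import Literature.AlgebraicGeometry.Resolution.DimensionFormula
import Mathlib.RingTheory.KrullDimension.NonZeroDivisors
import Mathlib.RingTheory.Support
import HarnessLib

/-!
# Heights in a regular local ring and dimensions of quotients of a module

Topic: `Literature/AlgebraicGeometry/Resolution` (dimension bookkeeping for the annihilator
theorems behind Macaulayfication, `ParameterColonAnnihilatorRegular.lean`).

* `height_add_ringKrullDim_quotient` — **the dimension formula in a regular local ring**:
  `ht P + dim S/P = dim S` for every prime `P` (Matsumura §5 p. 31: all maximal chains of primes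
  in a catenary local domain have length `dim`; regular local rings are catenary domains, tree
  `isCatenaryRing_of_isRegularLocalRing`).
* `natCast_le_height_of_ringKrullDim_quotient_add_le` — hence `ht J ≥ dim S - dim S/J`.
* `ringKrullDim_quotient_annihilator_sup` — `dim S/(Ann M + I) = dim Supp(M/IM)`
  (Stacks 00L3: `Supp(M/IM) = Supp M ∩ V(I)`).
* `le_height_annihilator_sup_ofList` — for a secant sequence `r₁,…,r_s ∈ 𝔪` of a finite module
  `M ≠ 0` over a regular local ring of dimension `n`, `dim M = d`:
  `ht(Ann M + (r₁,…,r_k)) ≥ n - d + k`.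

[cite: Matsumura1987, §5 p. 31; StacksProject, Tag 00L3; Cesnavicius2021, §3.2]
-/

noncomputable section

open IsLocalRing Ideal Module

universe u v

namespace Literature.AlgebraicGeometry.Resolution

variable {S : Type u} [CommRing S]

/-! ## The dimension formula in a regular local ring -/

/-- **Dimension formula in a regular local ring**: `ht P + dim S/P = dim S` for every prime `P`
(a regular local ring is a catenary Noetherian local domain — Matsumura Thm. 17.4 (ii), 17.8, 14.3 —
and in such a ring a saturated chain `0 ⊂ ⋯ ⊂ P` of length `ht P` followed by a saturated chain
`P ⊂ ⋯ ⊂ 𝔪` of length `dim S/P` is a maximal chain, of length `dim S`; Matsumura §5 p. 31).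
[cite: Matsumura1987, §5 p. 31] -/
theorem height_add_ringKrullDim_quotient [IsRegularLocalRing S] (P : Ideal S) [hP : P.IsPrime] :
    (P.height : WithBot ℕ∞) + ringKrullDim (S ⧸ P) = ringKrullDim S := by
  haveI := isDomain_of_isRegularLocalRing S
  have hS := isCatenaryRing_of_isRegularLocalRing S
  have hPm : P ≤ maximalIdeal S := IsLocalRing.le_maximalIdeal hP.ne_top
  have hform := hS.height_eq_height_add_height_map_quotientMk hPm
  haveI : Nontrivial (S ⧸ P) := Ideal.Quotient.nontrivial_iff.mpr hP.ne_top
  haveI : IsLocalRing (S ⧸ P) := .of_surjective' _ Ideal.Quotient.mk_surjective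
  rw [IsLocalRing.map_maximalIdeal_of_surjective _ Ideal.Quotient.mk_surjective] at hform
  rw [← IsLocalRing.maximalIdeal_height_eq_ringKrullDim,
    ← IsLocalRing.maximalIdeal_height_eq_ringKrullDim, hform, WithBot.coe_add]

/-- **Height bound from the dimension of the quotient** in a regular local ring: if
`dim S/J + r ≤ dim S` (and `J ≠ S`) then `r ≤ ht J` — every minimal prime `Q` of `J` has
`ht Q = dim S - dim S/Q ≥ dim S - dim S/J`. [cite: Matsumura1987, §5 p. 31] -/
theorem natCast_le_height_of_ringKrullDim_quotient_add_le [IsRegularLocalRing S] {J : Ideal S}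
    (hJ : J ≠ ⊤) {r : ℕ} (h : ringKrullDim (S ⧸ J) + r ≤ ringKrullDim S) :
    (r : ℕ∞) ≤ J.height := by
  rw [Ideal.height_eq_inf_minimalPrimes]
  refine le_iInf₂ fun Q hQ => ?_
  haveI hQp : Q.IsPrime := hQ.1.1
  have hJQ : J ≤ Q := hQ.1.2
  -- all dimensions and heights are natural numbers
  obtain ⟨n, hn⟩ := exists_nat_cast_eq_ringKrullDim (R := S)
  haveI : Nontrivial (S ⧸ Q) := Ideal.Quotient.nontrivial_iff.mpr hQp.ne_top
  haveI : IsLocalRing (S ⧸ Q) := .of_surjective' _ Ideal.Quotient.mk_surjective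
  haveI : Nontrivial (S ⧸ J) := Ideal.Quotient.nontrivial_iff.mpr hJ
  haveI : IsLocalRing (S ⧸ J) := .of_surjective' _ Ideal.Quotient.mk_surjective
  obtain ⟨e, he⟩ := exists_nat_cast_eq_ringKrullDim (R := S ⧸ Q)
  obtain ⟨f, hf⟩ := exists_nat_cast_eq_ringKrullDim (R := S ⧸ J)
  obtain ⟨q, hq⟩ := ENat.ne_top_iff_exists.mp (Q.height_ne_top hQp.ne_top)
  have hformula := height_add_ringKrullDim_quotient Q
  rw [← hq, he, hn] at hformula
  have h1 : q + e = n := by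
    have : ((q + e : ℕ) : WithBot ℕ∞) = n := by rw [← hformula]; rfl
    exact_mod_cast this
  -- `dim S/Q ≤ dim S/J`
  have h2 : ringKrullDim (S ⧸ Q) ≤ ringKrullDim (S ⧸ J) :=
    ringKrullDim_le_of_surjective (Ideal.Quotient.factor hJQ) (Ideal.Quotient.factor_surjective hJQ)
  rw [he, hf] at h2
  have h2' : e ≤ f := by exact_mod_cast h2
  rw [hf, hn] at h
  have h3 : f + r ≤ n := by
    have : ((f + r : ℕ) : WithBot ℕ∞) ≤ n := by exact_mod_cast h
    exact_mod_cast this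
  rw [← hq]
  exact_mod_cast (show r ≤ q by omega)

/-! ## Dimension of `M/IM` -/

section Module

variable (M : Type v) [AddCommGroup M] [Module S M]

/-- **`dim S/(Ann M + I) = dim Supp(M/IM)`** for a finite module `M`
(`Supp(M/IM) = Supp M ∩ V(I)`, Stacks 00L3, and `Supp M = V(Ann M)`). [cite: StacksProject, Tag 00L3] -/
theorem ringKrullDim_quotient_annihilator_sup [Module.Finite S M] (I : Ideal S) :
    ringKrullDim (S ⧸ (Module.annihilator S M ⊔ I)) =
      Module.supportDim S (M ⧸ (I • ⊤ : Submodule S M)) := by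
  rw [ringKrullDim_quotient, PrimeSpectrum.zeroLocus_sup, ← Module.support_eq_zeroLocus,
    ← Module.support_quotient]
  rfl

/-- The annihilator of a nonzero module over a local ring lies in `𝔪`. [folklore] -/
theorem annihilator_le_maximalIdeal [IsLocalRing S] [Nontrivial M] :
    Module.annihilator S M ≤ maximalIdeal S := by
  refine IsLocalRing.le_maximalIdeal fun h => ?_
  obtain ⟨m, hm⟩ := exists_ne (0 : M)
  exact hm (by simpa using Module.mem_annihilator.mp (h ▸ Submodule.mem_top : (1 : S) ∈ _) m)

/-- **Heights along a secant sequence**: for a finite module `M ≠ 0` of dimension `d` over a regular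
local ring `S` of dimension `n` and a secant sequence `r₁, …, r_s ∈ 𝔪` for `M`,
`ht(Ann M + (r₁, …, r_k)) ≥ n - d + k` for every `k ≤ s`: indeed
`dim S/(Ann M + (r₁,…,r_k)) = dim Supp(M/(r₁,…,r_k)M) = d - k` (Česnavičius 2021, §3.2) and
`ht J ≥ n - dim S/J` (dimension formula). [cite: Cesnavicius2021, §3.2] -/
theorem le_height_annihilator_sup_ofList [IsRegularLocalRing S] [Module.Finite S M] [Nontrivial M]
    {rs : List S} (hrs : IsSecantSequence M rs) (hmem : ∀ r ∈ rs, r ∈ maximalIdeal S)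
    {n d : ℕ} (hn : ringKrullDim S = n) (hd : Module.supportDim S M = d) {k : ℕ}
    (hk : k ≤ rs.length) :
    ((n - d + k : ℕ) : ℕ∞) ≤ (Module.annihilator S M ⊔ ofList (rs.take k)).height := by
  have hmemk : ∀ r ∈ rs.take k, r ∈ maximalIdeal S := fun r hr => hmem r (List.mem_of_mem_take hr)
  -- `dim Supp(M/(r₁,…,r_k)M) + k = d`
  have hdim := (hrs.take k).supportDim_quotient_add_length_eq hmemk
  rw [List.length_take, Nat.min_eq_left hk, hd] at hdim
  -- the ideal is proper
  have hne : Module.annihilator S M ⊔ ofList (rs.take k) ≠ ⊤ := by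
    refine fun h => IsLocalRing.maximalIdeal.isMaximal S |>.ne_top (top_le_iff.mp ?_)
    rw [← h]
    exact sup_le (annihilator_le_maximalIdeal M) (Ideal.span_le.mpr fun r hr => hmemk r hr)
  refine natCast_le_height_of_ringKrullDim_quotient_add_le hne ?_
  rw [ringKrullDim_quotient_annihilator_sup, hn]
  -- `dim Supp(M/…) = d - k` as a natural number
  haveI : IsLocalRing (S ⧸ (Module.annihilator S M ⊔ ofList (rs.take k))) := by
    haveI : Nontrivial (S ⧸ (Module.annihilator S M ⊔ ofList (rs.take k))) :=
      Ideal.Quotient.nontrivial_iff.mpr hne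
    exact .of_surjective' _ Ideal.Quotient.mk_surjective
  obtain ⟨f, hf⟩ :=
    exists_nat_cast_eq_ringKrullDim (R := S ⧸ (Module.annihilator S M ⊔ ofList (rs.take k)))
  rw [ringKrullDim_quotient_annihilator_sup] at hf
  rw [hf] at hdim ⊢
  have h1 : f + k = d := by
    have : ((f + k : ℕ) : WithBot ℕ∞) = d := by rw [← hdim]; rfl
    exact_mod_cast this
  have h2 : (d : WithBot ℕ∞) ≤ n := by
    rw [← hd, ← hn]
    exact Module.supportDim_le_ringKrullDim S M
  have h2' : d ≤ n := by exact_mod_cast h2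
  have : f + (n - d + k) = n := by omega
  exact_mod_cast this.le

end Module

end Literature.AlgebraicGeometry.Resolution

end
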